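import Mathlib
import Literature.ModelTheory.FiniteModelTheory.CountingWidthHamiltonicityProofs
import Summits.PneNP.PneNP.Theorems.SymmetryBudgetPolylogHamCut

/-!
# Linear counting width of Hamiltonian PATH (helper for item stmt-PneNP-2148
`SymmetryBudget.PolylogHam`, route route-PneNP-SymmetryBudget)

The Hamiltonian-PATH variant of Atserias–Dawar–Ochremiak 2021, Lemma 14 (arXiv:1901.07825; the
tree's `AtseriasDawarOchremiak2021_hamiltonicity_countingWidth_holds` is the CYCLE version):

  `hamPath_countingWidth`: there is `d > 0` such that for all large `N` and every `k`, if
  `≡^{C^k}`-equivalent graphs on `Fin N` simultaneously have a Hamiltonian path or not, then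
  `d·N ≤ k`

(Hamiltonian paths in listing form: a duplicate-free exhaustive `Adj`-chain). Not in print as
such ("a routine modification"); obtained here from the tree's hard pairs for Hamiltonicity —
the padded split graphs `padGraph (marked vr b) r` of the parity gadgets
(`Literature.ModelTheory.FiniteModelTheory.CountingWidthXorHam`) — by CUTTING the outermost
padding (`SymmetryBudgetPolylogHamCut.lean`): in `padGraph P (r+1) = subdivide (padGraph P r) a c`
the new vertex is detached from `a`, and the resulting graph has a Hamiltonian path iff
`padGraph P r` is Hamiltonian. The Cai–Fürer–Immerman / Atserias–Dawar game
(`ckEquiv_of_consistencyFamily`) is replayed verbatim on the cut graphs (`ckEquiv_cutPad`): the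
deleted edge joins two vertices fixed by all of Duplicator's flips (the newest padding vertex
and the mark `a`). The bookkeeping (`N = 573n + 7 + r`) copies the cycle version, with its
constant `XorHamGame.dConst`. No definitions are introduced (kernel-only helper file).
-/

-- `Summit.PneNP.PneNP.…` duplicates `PneNP` BY DESIGN (single-problem summit).
set_option linter.dupNamespace false

namespace Summit.PneNP.PneNP.Theorems

namespace PolylogHam

open Literature.Combinatorics.SimpleGraph Literature.Combinatorics.SimpleGraph.XorHam
open Literature.Combinatorics.SimpleGraph.XorHam.Vtx
open Literature.ModelTheory.FiniteModelTheory Literature.ModelTheory.FiniteModelTheory.XorHamGame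
open Literature.Computability.Complexity Literature.Computability.MetaComplexity Finset Filter

/-! ### The game on the cut padded gadgets -/

section Game

variable {n m : ℕ} {vr : Fin m → Fin 3 → Fin n}

/-- **The cut padded gadgets of a twisted and of the homogeneous system are `≡^{C^k}`** on an
`(s, q/p)`-boundary expander, whenever `2pK ≤ qs` and `3k ≤ K` — verbatim the transfer
`ckEquiv_padGraph`, run one padding level higher and through the deleted edge, which joins two
vertices fixed by every flip (the newest padding vertex and the mark `a`). -/
theorem ckEquiv_cutPad (hvr : ∀ u, Function.Injective (vr u)) {s p q K k : ℕ} (hs : 1 ≤ s)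
    (hq : 0 < q)
    (hexp : ∀ T : Finset (Fin m), T.card ≤ s →
      q * T.card ≤ p * (XorSystem.boundary (scope vr) T).card)
    (hK : 2 * p * K ≤ q * s) (hk : 3 * k ≤ K) (b : Fin m → ZMod 2) (r : ℕ) :
    CkEquiv k
      ((padGraph (marked vr b) (r + 1)).deleteEdges {s(none, some ((marked vr b).iter r).a)})
      ((padGraph (marked vr 0) (r + 1)).deleteEdges {s(none, some ((marked vr 0).iter r).a)}) := by
  classical
  have hG := isConsistencyFamily_good (S := scope vr) (b := b) hq hexp hK
  have hφ := isLocalFlipAction_pad (isLocalFlipAction_split (vr := vr)) (r + 1)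
  refine ckEquiv_of_consistencyFamily (R := ZMod 2) hG hφ
    (card_padD_le (fun z : Vtx n m × Fin 3 => card_vdata_le vr z.1) (r + 1))
    (fun dom f x y hgood hx hy => ?_) hk
  change Option (PadV (Vtx n m × Fin 3) r) at x y
  have ha : splitFlip (vr := vr) f (ce (Fin.last m), 2) = (ce (Fin.last m), 2) := rfl
  have hc : splitFlip (vr := vr) f (cx 0, 0) = (cx 0, 0) := rfl
  have hpad := padGraph_adj_iff (G := splitGraph (Arc vr b)) (G' := splitGraph (Arc vr 0))
    (a' := (ce (Fin.last m), 1)) ha hc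
    (fun x y hx hy => splitGraph_adj_flip_iff hvr hs hgood hx hy) (r + 1) x y hx hy
  have hmarks := iter_marks (splitGraph (Arc vr b)) (splitGraph (Arc vr 0)) (ce (Fin.last m), 2)
    (cx 0, 0) (ce (Fin.last m), 1) r
  have hfix := padEquiv_marks (splitGraph (Arc vr b)) (a' := (ce (Fin.last m), 1)) ha hc r
  rw [SimpleGraph.deleteEdges_adj, SimpleGraph.deleteEdges_adj]
  refine and_congr hpad (not_congr ?_)
  -- the deleted edge is fixed by the flip
  show s(Option.map (padEquiv (splitFlip (vr := vr) f) r) x,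
      Option.map (padEquiv (splitFlip (vr := vr) f) r) y) ∈
      ({s(none, some ((marked vr 0).iter r).a)} : Set (Sym2 (Option (PadV (Vtx n m × Fin 3) r)))) ↔
    s(x, y) ∈ ({s(none, some ((marked vr b).iter r).a)} : Set (Sym2 (Option (PadV (Vtx n m × Fin 3) r))))
  rw [Set.mem_singleton_iff, Set.mem_singleton_iff]
  have hinj := (padEquiv (splitFlip (vr := vr) f) r).injective
  have e2 : ∀ z : Option (PadV (Vtx n m × Fin 3) r),
      Option.map (padEquiv (splitFlip (vr := vr) f) r) z = none ↔ z = none := fun z => by simp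
  have e3 : ∀ z : Option (PadV (Vtx n m × Fin 3) r),
      Option.map (padEquiv (splitFlip (vr := vr) f) r) z = some ((marked vr 0).iter r).a ↔
        z = some ((marked vr b).iter r).a := by
    intro z
    cases z with
    | none => simp
    | some z =>
      rw [Option.map_some, Option.some.injEq, Option.some.injEq]
      show padEquiv (splitFlip (vr := vr) f) r z =
          ((⟨splitGraph (Arc vr 0), (ce (Fin.last m), 2), (cx 0, 0), (ce (Fin.last m), 1)⟩ :
            Marked _).iter r).a ↔
        z = ((⟨splitGraph (Arc vr b), (ce (Fin.last m), 2), (cx 0, 0), (ce (Fin.last m), 1)⟩ :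
            Marked _).iter r).a
      rw [← hmarks.1]
      conv_lhs => rw [← hfix.1]
      exact hinj.eq_iff
  rw [Sym2.eq_iff, Sym2.eq_iff, e2, e2, e3, e3]

/-- **The hard pair for Hamiltonian PATH on `N = 573n + 7 + r` vertices**: `G` has a Hamiltonian
path, `H` has none, and `H ≡^{C^k} G` whenever `3k ≤ ⌊s/4⌋` (`s` the expansion radius): the cut
padded gadgets of the homogeneous and of an unsolvable 3-XOR system, moved to `Fin N`. -/
theorem hard_pair_path {n : ℕ} (hn : 1 ≤ n) {c : Fin (2 * n) → ↥(kClauses 3 n)} {s : ℕ}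
    (hs : 1 ≤ s) (hexp : IsBoundaryExpander (fun i => clauseScope (c i : Clause ℕ)) s (1 / 2))
    {k : ℕ} (hk : 3 * k ≤ s / 4) (r N : ℕ) (hN : 573 * n + 6 + (r + 1) = N) :
    ∃ G H : SimpleGraph (Fin N),
      (∃ l : List (Fin N), l.Nodup ∧ (∀ v, v ∈ l) ∧ List.IsChain G.Adj l) ∧
      ¬ (∃ l : List (Fin N), l.Nodup ∧ (∀ v, v ∈ l) ∧ List.IsChain H.Adj l) ∧ CkEquiv k H G := by
  classical
  obtain ⟨b, hb⟩ := exists_unsat (show n < 2 * n by omega) (vrOf c)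
  have hcard : Fintype.card (PadV (Vtx n (2 * n) × Fin 3) (r + 1)) = N := by
    rw [card_padV, Fintype.card_prod, Fintype.card_fin, Vtx.card_vtx]; omega
  let e : PadV (Vtx n (2 * n) × Fin 3) (r + 1) ≃ Fin N := Fintype.equivFinOfCardEq hcard
  let G₀ := (padGraph (marked (vrOf c) 0) (r + 1)).deleteEdges
    {s(none, some ((marked (vrOf c) 0).iter r).a)}
  let H₀ := (padGraph (marked (vrOf c) b) (r + 1)).deleteEdges
    {s(none, some ((marked (vrOf c) b).iter r).a)}
  have h3 : 3 ≤ Fintype.card (PadV (Vtx n (2 * n) × Fin 3) r) := by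
    rw [card_padV]; exact le_add_right three_le_card
  refine ⟨G₀.map e, H₀.map e, ?_, ?_, ?_⟩
  · rw [← exists_hamPath_iff_of_iso (SimpleGraph.Iso.map e G₀)]
    exact exists_hamPath_cut_of_isHamiltonian ((marked (vrOf c) 0).iter r)
      ((marked_good (vr := vrOf c) 0).iter r) h3 (isHamiltonian_padGraph_zero (vrOf c) r)
  · rw [← exists_hamPath_iff_of_iso (SimpleGraph.Iso.map e H₀)]
    intro hH
    obtain ⟨x, hx⟩ := exists_solution_of_isHamiltonian_padGraph
      (isHamiltonian_of_hamPath_cut ((marked (vrOf c) b).iter r)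
        ((marked_good (vr := vrOf c) b).iter r) h3 hH)
    exact hb x hx
  · have hK : 2 * 2 * (s / 4) ≤ 1 * s := by omega
    exact (ckEquiv_cutPad (vrOf_injective c) hs one_pos (expansion_nat hexp) hK hk b r).iso_congr
      (SimpleGraph.Iso.map e H₀) (SimpleGraph.Iso.map e G₀)

end Game

/-! ### Linear counting width of Hamiltonian path -/

/-- The block size map `N ↦ n = (N - 7) / 573` tends to infinity. -/
theorem tendsto_blocks7 : Tendsto (fun N : ℕ => (N - 7) / 573) atTop atTop :=
  tendsto_atTop_atTop.2 fun b => ⟨573 * b + 7, fun N hN => by omega⟩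

/-- **Linear counting width of Hamiltonian PATH**: there is `d > 0` such that for all large `N`
and every `k`, if `≡^{C^k}`-equivalent graphs on `Fin N` simultaneously have a Hamiltonian path
(a duplicate-free exhaustive `Adj`-chain) or not, then `d·N ≤ k`. For every `N ≥ N₀` and every
`k < dN` the cut padded parity–Hamiltonicity gadgets of an unsolvable and of the homogeneous
3-XOR system over a boundary expander are `≡^{C^k}`-equivalent graphs on `Fin N` exactly one of
which has a Hamiltonian path (`hard_pair_path`); the constant `d` and the parameter bookkeeping
are those of the tree's cycle version (`XorHamGame.dConst`, `XorHamGame.eventually_params`). -/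
theorem hamPath_countingWidth : ∃ d : ℝ, 0 < d ∧ ∀ᶠ N : ℕ in atTop, ∀ k : ℕ,
    (∀ G H : SimpleGraph (Fin N), CkEquiv k G H →
      ((∃ l : List (Fin N), l.Nodup ∧ (∀ v, v ∈ l) ∧ List.IsChain G.Adj l) ↔
        ∃ l : List (Fin N), l.Nodup ∧ (∀ v, v ∈ l) ∧ List.IsChain H.Adj l)) →
    d * N ≤ k := by
  refine ⟨dConst, dConst_pos, ?_⟩
  filter_upwards [tendsto_blocks7.eventually eventually_params, eventually_ge_atTop 7] with
    N hN hN7 k hk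
  obtain ⟨hn3, hbig, hrad, hlin⟩ := hN
  by_contra hlt
  replace hlt := not_le.1 hlt
  set n := (N - 7) / 573 with hn
  have hNn : 573 * n + 7 ≤ N ∧ N < 573 * n + 580 := by omega
  obtain ⟨c, hc⟩ := exists_boundaryExpander hn3 hbig
  -- `3k ≤ ⌊radius/4⌋`
  have hk3 : 3 * k ≤ radius n / 4 := by
    have h1 : (k : ℝ) < dConst * N := hlt
    have h2 : (N : ℝ) ≤ 573 * n + 579 := by exact_mod_cast (show N ≤ 573 * n + 579 by omega)
    have h3 : (3 * k : ℝ) ≤ ((radius n / 4 : ℕ) : ℝ) := by nlinarith [dConst_pos]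
    exact_mod_cast h3
  obtain ⟨G, H, hG, hH, hHG⟩ :=
    hard_pair_path (by omega) hrad hc hk3 (N - (573 * n + 7)) N (by omega)
  exact hH ((hk H G hHG).2 hG)

end PolylogHam

end Summit.PneNP.PneNP.Theorems
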